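import Summits.BirchSwinnertonDyer.BirchSwinnertonDyer.Theorems.PrintCf2RubinValueTwoFrameSeedDyadicEmbedding
import Summits.BirchSwinnertonDyer.BirchSwinnertonDyer.Theorems.PrintCf2SplitBadTwoFrameFieldArithmetic
import Literature.NumberTheory.GaloisRepresentations.CharacterNormalisedGeneratorHeckeCharacter
import Mathlib.NumberTheory.LegendreSymbol.ZModChar
import HarnessLib

/-!
# The seed Größencharaktere `(α) ↦ σ(α)·χ(α mod 𝔭_v³)⁻¹` of `ℚ(√−7)` of modulus `𝔭_v³` at a split dyadic
# place (crux `stmt-BirchSwinnertonDyer-23721` `PrintCf2RubinValueTwo.RubinValueFormulaAtTwo`, line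
# `value-transport`, stub B18s `stub_frameSeed_two` — file 2 of the seed supply)

Cell `bsd-print-cf2`, seat `cruxlead-23721` g3.  Theses-free; `--supports` the crux; no definitions.
For the frame field `K ∋ √−7` (`h_K = 1`, `𝓞_Kˣ = {±1}`), a split dyadic place `v` (`ord_v 2 = 1`)
detected by a ring map `φ₀ : 𝓞 K → ℤ₂` (`k ∈ 𝔭_v ↔ 2 ∣ φ₀ k`, so `𝓞 K/𝔭_v³ ≅ ℤ/8`, file 1), the
embedding `σ : K → ℂ` of the unique infinite place, and ANY ODD character `χ : (ℤ/8)ˣ → {±1}`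
(`χ(−1) = −1`: the units condition `ε(u) = σ(u)` on `u = ±1`), **`exists_seedChar`** produces the
algebraic Hecke character `ω_χ` of the Größencharakter `(α) ↦ σ(α) · χ(φ₀(α) mod 8)⁻¹ mod 𝔭_v³`
(tree `heckeOfGross` ∘ `isGrossencharakter_charGenValue`, Ireland–Rosen Ch. 18 §7) with:
infinity type `(1, 0)`; unramified at every `w ≠ v`; `ω_χ(ϖ_w) = σ(g) χ(φ₀ g mod 8)⁻¹` for some global
`g ∉ 𝔭_v` (a generator of `𝔭_w`); **local values at `v`**: `ω_χ(⟨a⟩_v) = χ(φ₀ a mod 8)` for every global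
`a ∉ 𝔭_v` (Tate, Cassels–Fröhlich VII §4: `ω((a)) = 1`), and `ω_χ(⟨q⟩_v) = 1` for every `q ∈ K_v` with
`|q − 1|_v ≤ |8|_v` (the congruence subgroup of the modulus `𝔭_v³`).  The two odd characters
`χ₈'` (↔ `χ₋₈`) and `χ₄χ₈ = χ₈χ₈'` (↔ `χ₋₄`) give the seeds of the four `2`-adic unit types of a quadratic
`θK` at `v` (files 3–5).

HONEST FRAMING: assembly of the tree's Größencharakter-to-Hecke-character construction and its
conductor bookkeeping; closes nothing by itself; beyond-print theorem: no.  BSD is not proved by any of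
this.

References: [IrelandRosen1982] Ch. 18 §7; [CasselsFrohlichANT1967] Ch. VII §4 Prop. 4.1;
[NeukirchANT1999] Ch. VII §6 (6.13)–(6.14); [deShalit1987] II.4.17 (54).
-/

-- the summit namespace `Summit.BirchSwinnertonDyer.BirchSwinnertonDyer` repeats the problem name by design (D-0017)
set_option linter.dupNamespace false
set_option autoImplicit false

noncomputable section

open scoped Classical

open NumberField IsDedekindDomain Literature.NumberTheory.GaloisRepresentations
  Literature.NumberTheory.EllipticCurves

namespace Summit.BirchSwinnertonDyer.BirchSwinnertonDyer.Theorems.PrintCf2.FrameSeed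

variable {K : Type} [Field K] [NumberField K]

/-! ## §1 The modulus `𝔭_v³` -/

section Modulus

variable (v : HeightOneSpectrum (𝓞 K))

/-- `𝔭_v³ ≤ 𝔭_w` only for `w = v`. [folklore] -/
theorem eq_of_pow_three_le {w : HeightOneSpectrum (𝓞 K)} (h : v.asIdeal ^ 3 ≤ w.asIdeal) : w = v := by
  rw [Ideal.IsPrime.pow_le_iff (by norm_num)] at h
  exact HeightOneSpectrum.ext ((v.isMaximal.eq_of_le w.isPrime.ne_top h).symm)

/-- The exponent of `𝔭_v` in the modulus `𝔭_v³` is `3`. [folklore] -/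
theorem modulusExp_pow_three_self : modulusExp (v.asIdeal ^ 3) v = 3 := by
  rw [modulusExp, Associates.mk_pow, Associates.count_pow (Associates.mk_ne_zero.mpr v.ne_bot)
    v.associates_irreducible, Associates.count_self v.associates_irreducible, mul_one]

/-- The exponent of `𝔭_w`, `w ≠ v`, in the modulus `𝔭_v³` is `0`. [folklore] -/
theorem modulusExp_pow_three_of_ne {w : HeightOneSpectrum (𝓞 K)} (hw : w ≠ v) : modulusExp (v.asIdeal ^ 3) w = 0 := by
  by_contra h
  exact hw (eq_of_pow_three_le v ((modulusExp_ne_zero_iff _ (pow_ne_zero 3 v.ne_bot) w).mp h))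

/-- An integer off `𝔭_v` generates an ideal prime to `𝔭_v³`. [folklore] -/
theorem isCoprime_span_pow_three {a : 𝓞 K} (ha : a ∉ v.asIdeal) : IsCoprime (Ideal.span {a}) (v.asIdeal ^ 3) := by
  refine IsCoprime.pow_right (Ideal.isCoprime_iff_sup_eq.mpr ?_)
  refine (v.isMaximal.1.2 _ (lt_of_le_of_ne le_sup_right fun h ↦ ha ?_))
  rw [h]
  exact le_sup_left (b := v.asIdeal) (Ideal.mem_span_singleton_self a)

/-- **A local idele `⟨q⟩_v` with `|q − 1|_v ≤ |ϖ_v|³` lies in the congruence subgroup of the modulus `𝔭_v³`**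
(`K` totally complex: no condition at infinity). [cite: NeukirchANT1999, Ch. VI §1 (1.7)–(1.9)] -/
theorem localUnits_mem_congruenceIdeles_pow_three [IsTotallyComplex K] (q : (v.adicCompletion K)ˣ)
    (hq : Valued.v ((q : v.adicCompletion K) - 1) ≤ WithZero.exp (-(3 : ℤ))) :
    localUnits v q ∈ congruenceIdeles (v.asIdeal ^ 3) := by
  refine ⟨fun w hw ↦ ?_, fun w hw ↦ absurd hw ?_⟩
  · have hwv : w = v := eq_of_pow_three_le v ((modulusExp_ne_zero_iff _ (pow_ne_zero 3 v.ne_bot) w).mp hw)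
    subst hwv
    rw [localUnits_snd_apply_self, modulusExp_pow_three_self]
    exact_mod_cast hq
  · exact InfinitePlace.not_isReal_iff_isComplex.mpr (IsTotallyComplex.isComplex w)

end Modulus

/-! ## §2 The seed Größencharakter of an odd character of `(ℤ/8)ˣ` -/

section Seed

variable (hK : IsImaginaryQuadratic K) {θ : K} (hθ : θ ^ 2 = -7)
  {e : K →+* ℂ} (he : ∀ w : InfinitePlace K, w.embedding = e)
  {v : HeightOneSpectrum (𝓞 K)} {φ₀ : 𝓞 K →+* ℤ_[2]}
  (hv : ∀ k : 𝓞 K, k ∈ v.asIdeal ↔ (2 : ℤ_[2]) ∣ φ₀ k)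
include hK hθ he hv

/-- **The seed Größencharaktere of two odd characters `χ₁, χ₂` of `(ℤ/8)ˣ`.**  `K` imaginary quadratic
with `√−7 ∈ K`, `e` the embedding of its infinite place, `v` a place detected by `φ₀ : 𝓞 K → ℤ₂`
(`k ∈ 𝔭_v ↔ 2 ∣ φ₀ k`), `χᵢ : MulChar (ZMod 8) ℤ` with `χᵢ(−1) = −1`.  There are Hecke characters `ω₁, ω₂`
of `K` — those of the Größencharaktere `(α) ↦ e(α)·χᵢ(φ₀ α mod 8)⁻¹ mod 𝔭_v³` — with: (i) infinity type
`(1, 0)`; (ii) unramified at every `w ≠ v`; (iii) at `w ≠ v`, `ωᵢ(ϖ_w) = e(g) · χᵢ(φ₀ g mod 8)⁻¹` for one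
and the same global `g ∉ 𝔭_v` (a generator of `𝔭_w`); (iv) `ωᵢ(⟨a⟩_v) = χᵢ(φ₀ a mod 8)` for every global
`a ∉ 𝔭_v`; (v) `ωᵢ(⟨q⟩_v) = 1` whenever `|q − 1|_v ≤ |ϖ_v|³`. [cite: IrelandRosen1982, Ch. 18 §7]
[cite: CasselsFrohlichANT1967, Ch. VII §4 Prop. 4.1] [cite: NeukirchANT1999, Ch. VII §6 Cor. (6.14)] -/
theorem exists_seedChar_pair (χ₁ χ₂ : MulChar (ZMod 8) ℤ) (hχ₁ : χ₁ (-1) = -1) (hχ₂ : χ₂ (-1) = -1) :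
    ∃ ω₁ ω₂ : HeckeCharacter K,
      (ω₁.HasInfinityType (fun _ ↦ 1) (fun _ ↦ 0) ∧ ω₂.HasInfinityType (fun _ ↦ 1) (fun _ ↦ 0)) ∧
      (∀ w : HeightOneSpectrum (𝓞 K), w ≠ v → ω₁.IsUnramifiedAt w ∧ ω₂.IsUnramifiedAt w) ∧
      (∀ w : HeightOneSpectrum (𝓞 K), w ≠ v → ∃ g : 𝓞 K, g ∉ v.asIdeal ∧
        ω₁.valueAtUniformizer w = e (g : K) * (((χ₁ (PadicInt.toZModPow 3 (φ₀ g)) : ℤ) : ℂ))⁻¹ ∧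
        ω₂.valueAtUniformizer w = e (g : K) * (((χ₂ (PadicInt.toZModPow 3 (φ₀ g)) : ℤ) : ℂ))⁻¹) ∧
      (∀ (a : 𝓞 K), a ∉ v.asIdeal → ∀ ha : algebraMap K (v.adicCompletion K) (a : K) ≠ 0,
        ((ω₁ (localUnits v (Units.mk0 _ ha)) : ℂˣ) : ℂ) = ((χ₁ (PadicInt.toZModPow 3 (φ₀ a)) : ℤ) : ℂ) ∧
        ((ω₂ (localUnits v (Units.mk0 _ ha)) : ℂˣ) : ℂ) = ((χ₂ (PadicInt.toZModPow 3 (φ₀ a)) : ℤ) : ℂ)) ∧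
      (∀ q : (v.adicCompletion K)ˣ, Valued.v ((q : v.adicCompletion K) - 1) ≤ WithZero.exp (-(3 : ℤ)) →
        ω₁ (localUnits v q) = 1 ∧ ω₂ (localUnits v q) = 1) := by
  haveI : IsPrincipalIdealRing (𝓞 K) := FirstLayer.isPrincipalIdealRing_of_sq_eq_neg_seven hK hθ
  haveI : IsTotallyComplex K := hK.2
  -- the modulus and the reduction `𝓞 K ⧸ 𝔭_v³ → ℤ/8`
  set 𝔣 : Ideal (𝓞 K) := v.asIdeal ^ 3 with h𝔣def
  have h𝔣 : 𝔣 ≠ ⊥ := pow_ne_zero 3 v.ne_bot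
  have h𝔣v : 𝔣 ≤ v.asIdeal := Ideal.pow_le_self (by norm_num)
  set red : 𝓞 K →+* ZMod 8 := (PadicInt.toZModPow 3).comp φ₀ with hred
  have hred_apply : ∀ k, red k = PadicInt.toZModPow 3 (φ₀ k) := fun k ↦ rfl
  have hker : ∀ a ∈ 𝔣, red a = 0 := fun a ha ↦
    (toZModPow_eq_zero_iff 3 a).mpr (pow_dvd_of_mem_pow hv ha)
  set j : 𝓞 K ⧸ 𝔣 →+* ZMod 8 := Ideal.Quotient.lift 𝔣 red hker with hj
  have hj_mk : ∀ k, j (Ideal.Quotient.mk 𝔣 k) = red k := fun k ↦ Ideal.Quotient.lift_mk 𝔣 red hker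
  -- the generator of `𝔭_w`, `w ≠ v`, lies off `𝔭_v`
  have hgen : ∀ w : HeightOneSpectrum (𝓞 K), w ≠ v → Submodule.IsPrincipal.generator w.asIdeal ∉ v.asIdeal := by
    intro w hw hgv
    apply hw
    refine HeightOneSpectrum.ext (w.isMaximal.eq_of_le v.isPrime.ne_top ?_)
    rw [← Ideal.span_singleton_generator w.asIdeal]
    exact (Ideal.span_singleton_le_iff_mem _).mpr hgv
  -- one odd character at a time
  have main : ∀ χ : MulChar (ZMod 8) ℤ, χ (-1) = -1 → ∃ ω : HeckeCharacter K,
      ω.HasInfinityType (fun _ ↦ 1) (fun _ ↦ 0) ∧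
      (∀ w : HeightOneSpectrum (𝓞 K), w ≠ v → ω.IsUnramifiedAt w) ∧
      (∀ w : HeightOneSpectrum (𝓞 K), w ≠ v → ω.valueAtUniformizer w =
        e ((Submodule.IsPrincipal.generator w.asIdeal : 𝓞 K) : K) *
          (((χ (PadicInt.toZModPow 3 (φ₀ (Submodule.IsPrincipal.generator w.asIdeal))) : ℤ) : ℂ))⁻¹) ∧
      (∀ (a : 𝓞 K), a ∉ v.asIdeal → ∀ ha : algebraMap K (v.adicCompletion K) (a : K) ≠ 0,
        ((ω (localUnits v (Units.mk0 _ ha)) : ℂˣ) : ℂ) = ((χ (PadicInt.toZModPow 3 (φ₀ a)) : ℤ) : ℂ)) ∧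
      (∀ q : (v.adicCompletion K)ˣ, Valued.v ((q : v.adicCompletion K) - 1) ≤ WithZero.exp (-(3 : ℤ)) →
        ω (localUnits v q) = 1) := by
    intro χ hχ
    -- the character `ε = χ ∘ j` on the units of `𝓞 K ⧸ 𝔣`
    set f : (𝓞 K ⧸ 𝔣)ˣ →* ℂˣ :=
      (Units.map ((Int.castRingHom ℂ : ℤ →+* ℂ) : ℤ →* ℂ)).comp (χ.toUnitHom.comp (Units.map (j : 𝓞 K ⧸ 𝔣 →* ZMod 8)))
      with hf
    set ε : MulChar (𝓞 K ⧸ 𝔣) ℂ := MulChar.ofUnitHom f with hε_def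
    -- values of `ε` on classes of global integers off `v`
    have hε_apply : ∀ a : 𝓞 K, a ∉ v.asIdeal →
        ε (Ideal.Quotient.mk 𝔣 a) = ((χ (PadicInt.toZModPow 3 (φ₀ a)) : ℤ) : ℂ) := by
      intro a ha
      obtain ⟨u, hu⟩ := isUnit_mk_of_isCoprime_span (isCoprime_span_pow_three v ha)
      rw [← hu, hε_def, MulChar.ofUnitHom_coe, hf]
      simp only [MonoidHom.comp_apply, Units.coe_map, MonoidHom.coe_coe, eq_intCast, MulChar.coe_toUnitHom]
      rw [hu, hj_mk, hred_apply]
    -- the units condition (`u = ±1`)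
    have hε : ∀ u : (𝓞 K)ˣ, ε (Ideal.Quotient.mk 𝔣 u) = e ((u : 𝓞 K) : K) := by
      intro u
      have h1v : (1 : 𝓞 K) ∉ v.asIdeal := fun h ↦ v.isPrime.ne_top ((Ideal.eq_top_iff_one _).mpr h)
      rcases FirstLayer.units_eq_one_or_eq_neg_one hK hθ u with rfl | rfl
      · rw [Units.val_one, map_one, MulChar.map_one, RingOfIntegers.coe_eq_algebraMap, map_one, map_one]
      · have hn1 : ((-1 : (𝓞 K)ˣ) : 𝓞 K) = -1 := by rw [Units.val_neg, Units.val_one]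
        have hn1v : (-1 : 𝓞 K) ∉ v.asIdeal := fun h ↦ h1v (by simpa using v.asIdeal.neg_mem h)
        rw [hn1, hε_apply (-1) hn1v, map_neg, map_one, map_neg, map_one, hχ, RingOfIntegers.coe_eq_algebraMap,
          map_neg, map_one, map_neg, map_one]
        push_cast
        rfl
    -- the Hecke character
    have hG := isGrossencharakter_charGenValue e ε hε
    refine ⟨heckeOfGross h𝔣 hG, ?_, ?_, ?_, ?_, ?_⟩
    · -- (i) infinity type
      have h := heckeOfGross_hasInfinityType h𝔣 hG
      obtain ⟨h1, h0⟩ := embType_eq_one_of_forall he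
      rw [← h1, ← h0]
      exact h
    · -- (ii) unramified off `v`
      intro w hw
      exact heckeOfGross_isUnramifiedAt h𝔣 hG (fun h ↦ hw (eq_of_pow_three_le v h))
    · -- (iii) Frobenius values
      intro w hw
      have hwle : ¬ 𝔣 ≤ w.asIdeal := fun h ↦ hw (eq_of_pow_three_le v h)
      rw [heckeOfGross_valueAtUniformizer h𝔣 hG hwle, charGenValue, charNormValue_apply, hε_apply _ (hgen w hw)]
    · -- (iv) local values at `v` on global integers
      intro a ha haK
      have ha0 : a ≠ 0 := fun h ↦ ha (h ▸ v.asIdeal.zero_mem)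
      have hcop : IsCoprime (Ideal.span {a}) 𝔣 := isCoprime_span_pow_three v ha
      have hcong : ∀ w : HeightOneSpectrum (𝓞 K), w ≠ v → modulusExp 𝔣 w ≠ 0 →
          a - 1 ∈ w.asIdeal ^ modulusExp 𝔣 w := fun w hw h ↦ absurd (modulusExp_pow_three_of_ne v hw) h
      have key := heckeOfGross_localUnits_mul_idealPow h𝔣 hG h𝔣v hcop hcong haK
      rw [idealPow_charGenValue_span e ε hε ha0, prod_embedding_zpow_embType, charNormValue_apply,
        hε_apply a ha] at key
      have he0 : e (a : K) ≠ 0 := (map_ne_zero e).mpr (by exact_mod_cast ha0)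
      have hχ0 : (((χ (PadicInt.toZModPow 3 (φ₀ a)) : ℤ) : ℂ)) ≠ 0 := by
        obtain ⟨u, hu⟩ := isUnit_toZModPow_of_not_mem hv 3 ha
        rw [← hu, ← MulChar.coe_toUnitHom]
        exact_mod_cast (χ.toUnitHom u).ne_zero
      field_simp at key
      linear_combination key
    · -- (v) the congruence subgroup
      intro q hq
      rw [heckeOfGross_apply_of_mem h𝔣 hG (localUnits_mem_congruenceIdeles_pow_three v q hq),
        grossIdeleValue_localUnits, grossUnitValue_of_le hG h𝔣v, one_zpow]
  obtain ⟨ω₁, h₁i, h₁u, h₁f, h₁l, h₁c⟩ := main χ₁ hχ₁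
  obtain ⟨ω₂, h₂i, h₂u, h₂f, h₂l, h₂c⟩ := main χ₂ hχ₂
  exact ⟨ω₁, ω₂, ⟨h₁i, h₂i⟩, fun w hw ↦ ⟨h₁u w hw, h₂u w hw⟩,
    fun w hw ↦ ⟨_, hgen w hw, h₁f w hw, h₂f w hw⟩, fun a ha haK ↦ ⟨h₁l a ha haK, h₂l a ha haK⟩,
    fun q hq ↦ ⟨h₁c q hq, h₂c q hq⟩⟩

end Seed

end Summit.BirchSwinnertonDyer.BirchSwinnertonDyer.Theorems.PrintCf2.FrameSeed

end
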